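import Literature.Analysis.Complex.StripResidueFormula
import Mathlib.Analysis.Fourier.Inversion
import Mathlib.Analysis.Calculus.ParametricIntegral
import HarnessLib

/-!
# Injectivity of the kernel `e^{−φt}/(e^{πt} + e^{−πt})`, `−π < φ < π`
# (Rieffel–van Daele, proof of Lemma 4.8)

Rieffel–van Daele, *A bounded operator approach to Tomita–Takesaki theory*, Pacific J. Math. 69
(1977), proof of Lemma 4.8: if `g` is a bounded continuous function on `ℝ` with
`∫ e^{−φt} (e^{πt} + e^{−πt})^{−1} g(t) dt = 0` for all `−π < φ < π`, then `g = 0`: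

> "But then `g` itself must vanish. To see this, let `f(z) = ∫ e^{−zt} (e^{πt}+e^{−πt})^{−1} g(t) dt`
> for `|Re z| < π`. Then in this region `f` will be analytic. But it vanishes for real `z`, and
> so vanishes everywhere. In particular it vanishes for `z = is` for any real `s`. But then from
> the injectivity of the Fourier transform it follows that `g` vanishes."

We follow this: analyticity of the parametric integral by differentiation under the integral
sign (`hasDerivAt_integral_of_dominated_loc_of_deriv_le`), the identity theorem
(`AnalyticOnNhd.eqOn_zero_of_preconnected_of_frequently_eq_zero`), and Mathlib's Fourier
inversion theorem (`Continuous.fourierInv_fourier_eq`). The kernel is the `weight φ t` of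
`Literature.Analysis.Complex.StripResidueFormula` (Rieffel–van Daele Lemma 4.6), whose
elementary estimates (`integrable_exp_neg_mul_abs`, `inv_exp_add_exp_le`,
`continuous_inv_exp_add_exp`) are reused.

## Main result

* `eq_zero_of_forall_integral_coshKernel_eq_zero`.

## References
* M. A. Rieffel, A. van Daele, *A bounded operator approach to Tomita–Takesaki theory*, Pacific
  J. Math. 69 (1977) 187–221, Lemma 4.8 (proof). [RieffelVandaele1977]
-/

noncomputable section

open Complex MeasureTheory Filter Set Metric
open scoped Real Topology FourierTransform

namespace Literature.Analysis.Fourier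

/-! ### Exponential integrability lemmas -/

/-- `|t| e^{−b|t|} ≤ (2/b) e^{−(b/2)|t|}`. [folklore] -/
theorem abs_mul_exp_neg_le {b : ℝ} (hb : 0 < b) (t : ℝ) :
    |t| * Real.exp (-b * |t|) ≤ (2 / b) * Real.exp (-(b / 2) * |t|) := by
  have h1 : b / 2 * |t| ≤ Real.exp (b / 2 * |t|) := by
    have := Real.add_one_le_exp (b / 2 * |t|)
    linarith
  have h2 : |t| ≤ (2 / b) * Real.exp (b / 2 * |t|) := by
    rw [div_mul_eq_mul_div, le_div_iff₀ hb]
    linarith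
  calc |t| * Real.exp (-b * |t|) ≤ (2 / b) * Real.exp (b / 2 * |t|) * Real.exp (-b * |t|) := by
        gcongr
    _ = (2 / b) * Real.exp (-(b / 2) * |t|) := by
        rw [mul_assoc, ← Real.exp_add]; ring_nf

/-- Integrability of `|t| e^{−b|t|}`. [folklore] -/
theorem integrable_abs_mul_exp_neg_mul_abs {b : ℝ} (hb : 0 < b) :
    Integrable fun t : ℝ => |t| * Real.exp (-b * |t|) := by
  refine ((Literature.Analysis.Complex.integrable_exp_neg_mul_abs (half_pos hb)).const_mul (2 / b)).mono'
    (by fun_prop) ?_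
  refine Eventually.of_forall fun t => ?_
  rw [Real.norm_eq_abs, abs_of_nonneg (by positivity)]
  exact abs_mul_exp_neg_le hb t

/-! ### The kernel and the analytic function `F` -/

/-- The weight `1/(e^{πt} + e^{−πt})` (`= weight 0 t` of the Lemma 4.6 file). [cite: RieffelVandaele1977, Lemma 4.8 (proof)] -/
def sechWeight (t : ℝ) : ℝ := 1 / (Real.exp (π * t) + Real.exp (-(π * t)))

/-- `sechWeight = weight 0`. [folklore] -/
theorem sechWeight_eq_weight_zero (t : ℝ) : sechWeight t = Literature.Analysis.Complex.weight 0 t := by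
  rw [sechWeight, Literature.Analysis.Complex.weight, zero_mul, neg_zero, Real.exp_zero]

/-- `0 < 1/(e^{πt} + e^{−πt})`. [folklore] -/
theorem sechWeight_pos (t : ℝ) : 0 < sechWeight t := by unfold sechWeight; positivity

/-- The weight is continuous (`continuous_inv_exp_add_exp`). [folklore] -/
theorem continuous_sechWeight : Continuous sechWeight :=
  Literature.Analysis.Complex.continuous_inv_exp_add_exp

/-- `1/(e^{πt} + e^{−πt}) ≤ e^{−π|t|}` (`inv_exp_add_exp_le`). [folklore] -/
theorem sechWeight_le (t : ℝ) : sechWeight t ≤ Real.exp (-π * |t|) :=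
  Literature.Analysis.Complex.inv_exp_add_exp_le t

variable {g : ℝ → ℂ}

/-- The function `h(t) = g(t)/(e^{πt} + e^{−πt})`. [cite: RieffelVandaele1977, Lemma 4.8 (proof)] -/
def hFun (g : ℝ → ℂ) (t : ℝ) : ℂ := (sechWeight t : ℂ) * g t

/-- `‖h t‖ ≤ C e^{−π|t|}`. [folklore] -/
theorem norm_hFun_le {C : ℝ} (hC : ∀ t, ‖g t‖ ≤ C) (t : ℝ) :
    ‖hFun g t‖ ≤ C * Real.exp (-π * |t|) := by
  have hC0 : 0 ≤ C := le_trans (norm_nonneg _) (hC 0)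
  rw [hFun, norm_mul, Complex.norm_real, Real.norm_eq_abs, abs_of_pos (sechWeight_pos t), mul_comm]
  exact mul_le_mul (hC t) (sechWeight_le t) (sechWeight_pos t).le hC0

/-- `h` is continuous. [folklore] -/
theorem continuous_hFun (hg : Continuous g) : Continuous (hFun g) :=
  (Complex.continuous_ofReal.comp continuous_sechWeight).mul hg

/-- `h` is integrable. [folklore] -/
theorem integrable_hFun (hg : Continuous g) {C : ℝ} (hC : ∀ t, ‖g t‖ ≤ C) : Integrable (hFun g) :=
  Integrable.mono' ((Literature.Analysis.Complex.integrable_exp_neg_mul_abs Real.pi_pos).const_mul C)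
    (continuous_hFun hg).aestronglyMeasurable (Eventually.of_forall (norm_hFun_le hC))

/-- The open strip `|Re z| < π`. [cite: RieffelVandaele1977, Lemma 4.8 (proof)] -/
def piStrip : Set ℂ := {z : ℂ | |z.re| < π}

/-- The strip is open. [folklore] -/
theorem isOpen_piStrip : IsOpen piStrip :=
  isOpen_lt (continuous_abs.comp Complex.continuous_re) continuous_const

/-- The strip is convex, hence preconnected. [folklore] -/
theorem isPreconnected_piStrip : IsPreconnected piStrip := by
  refine Convex.isPreconnected ?_
  have : piStrip = Complex.re ⁻¹' Set.Ioo (-π) π := by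
    ext z; simp [piStrip, abs_lt]
  rw [this]
  exact (convex_Ioo (-π) π).linear_preimage Complex.reLm

/-- The Laplace-type transform `F(z) = ∫ e^{−zt} h(t) dt`. [cite: RieffelVandaele1977, Lemma 4.8 (proof)] -/
def FFun (g : ℝ → ℂ) (z : ℂ) : ℂ := ∫ t : ℝ, Complex.exp (-(z * t)) * hFun g t

/-- `‖e^{−zt}‖ ≤ e^{a|t|}` when `|Re z| ≤ a`. [folklore] -/
theorem norm_exp_neg_mul_le {z : ℂ} {a : ℝ} (hz : |z.re| ≤ a) (t : ℝ) :
    ‖Complex.exp (-(z * t))‖ ≤ Real.exp (a * |t|) := by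
  rw [Complex.norm_exp, Real.exp_le_exp]
  have : (-(z * (t : ℂ))).re = -(z.re * t) := by simp
  rw [this]
  calc -(z.re * t) ≤ |z.re * t| := neg_le_abs _
    _ = |z.re| * |t| := abs_mul _ _
    _ ≤ a * |t| := by gcongr

/-- **`F` is complex differentiable on the strip** (differentiation under the integral sign).
[cite: RieffelVandaele1977, Lemma 4.8 (proof)] -/
theorem differentiableOn_FFun (hg : Continuous g) {C : ℝ} (hC : ∀ t, ‖g t‖ ≤ C) :
    DifferentiableOn ℂ (FFun g) piStrip := by
  intro z₀ hz₀
  have hC0 : 0 ≤ C := le_trans (norm_nonneg _) (hC 0)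
  simp only [piStrip, mem_setOf_eq] at hz₀
  -- a margin `δ` with `|Re z₀| + δ < π`
  set a : ℝ := |z₀.re| with ha
  set δ : ℝ := (π - a) / 2 with hδ
  have hδpos : 0 < δ := by rw [hδ]; linarith
  have hgap : 0 < π - (a + δ) := by rw [hδ]; linarith
  -- the derivative integrand and the bound
  set F' : ℂ → ℝ → ℂ := fun z t => -(t : ℂ) * (Complex.exp (-(z * t)) * hFun g t) with hF'
  set bound : ℝ → ℝ := fun t => C * (|t| * Real.exp (-(π - (a + δ)) * |t|)) with hbound
  have hmeas : ∀ z : ℂ, AEStronglyMeasurable (fun t : ℝ => Complex.exp (-(z * t)) * hFun g t) volume := by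
    intro z
    exact ((Complex.continuous_exp.comp (by fun_prop)).mul (continuous_hFun hg)).aestronglyMeasurable
  have hint : ∀ z : ℂ, |z.re| < π → Integrable (fun t : ℝ => Complex.exp (-(z * t)) * hFun g t) := by
    intro z hz
    refine Integrable.mono' ((Literature.Analysis.Complex.integrable_exp_neg_mul_abs (sub_pos.2 hz)).const_mul C)
      (hmeas z)
      (Eventually.of_forall fun t => ?_)
    rw [norm_mul]
    calc ‖Complex.exp (-(z * t))‖ * ‖hFun g t‖ ≤ Real.exp (|z.re| * |t|) * (C * Real.exp (-π * |t|)) :=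
          mul_le_mul (norm_exp_neg_mul_le le_rfl t) (norm_hFun_le hC t) (norm_nonneg _) (by positivity)
      _ = C * Real.exp (-(π - |z.re|) * |t|) := by
          rw [mul_left_comm, ← Real.exp_add]; ring_nf
  have key := hasDerivAt_integral_of_dominated_loc_of_deriv_le (μ := volume) (x₀ := z₀)
    (F := fun (z : ℂ) (t : ℝ) => Complex.exp (-(z * t)) * hFun g t) (F' := F') (bound := bound)
    (ball_mem_nhds z₀ hδpos) (Eventually.of_forall hmeas) (hint z₀ hz₀) ?_ ?_ ?_ ?_
  · exact (key.2.differentiableAt).differentiableWithinAt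
  · rw [hF']
    exact ((continuous_ofReal.neg).mul ((Complex.continuous_exp.comp (by fun_prop)).mul
      (continuous_hFun hg))).aestronglyMeasurable
  · refine Eventually.of_forall fun t z hz => ?_
    simp only [hF', hbound]
    have hzre : |z.re| ≤ a + δ := by
      have h1 : |z.re - z₀.re| ≤ ‖z - z₀‖ := by
        simpa using abs_re_le_norm (z - z₀)
      have h2 : ‖z - z₀‖ < δ := mem_ball_iff_norm.1 hz
      calc |z.re| = |z₀.re + (z.re - z₀.re)| := by ring_nf
        _ ≤ |z₀.re| + |z.re - z₀.re| := abs_add_le _ _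
        _ ≤ a + δ := by rw [ha]; linarith
    simp only [norm_mul, norm_neg, Complex.norm_real, Real.norm_eq_abs]
    calc |t| * (‖Complex.exp (-(z * t))‖ * ‖hFun g t‖)
        ≤ |t| * (Real.exp ((a + δ) * |t|) * (C * Real.exp (-π * |t|))) := by
          gcongr
          · exact norm_exp_neg_mul_le hzre t
          · exact norm_hFun_le hC t
      _ = C * (|t| * Real.exp (-(π - (a + δ)) * |t|)) := by
          rw [show Real.exp ((a + δ) * |t|) * (C * Real.exp (-π * |t|)) =
            C * (Real.exp ((a + δ) * |t|) * Real.exp (-π * |t|)) by ring, ← Real.exp_add]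
          ring_nf
  · rw [hbound]
    exact (integrable_abs_mul_exp_neg_mul_abs hgap).const_mul C
  · refine Eventually.of_forall fun t z _ => ?_
    simp only [hF']
    have h1 : HasDerivAt (fun w : ℂ => -(w * t)) (-(t : ℂ)) z :=
      (hasDerivAt_mul_const (t : ℂ)).neg
    have h2 := h1.cexp.mul_const (hFun g t)
    change HasDerivAt (fun w : ℂ => Complex.exp (-(w * t)) * hFun g t)
      (-(t : ℂ) * (Complex.exp (-(z * t)) * hFun g t)) z
    exact h2.congr_deriv (by ring)

/-- `F` is analytic on the strip. [cite: RieffelVandaele1977, Lemma 4.8 (proof)] -/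
theorem analyticOnNhd_FFun (hg : Continuous g) {C : ℝ} (hC : ∀ t, ‖g t‖ ≤ C) :
    AnalyticOnNhd ℂ (FFun g) piStrip :=
  (differentiableOn_FFun hg hC).analyticOnNhd isOpen_piStrip

/-- On real points `φ` of the strip, `F(φ)` is the weighted integral of the hypothesis.
[cite: RieffelVandaele1977, Lemma 4.8 (proof)] -/
theorem FFun_ofReal (φ : ℝ) :
    FFun g φ = ∫ t : ℝ, (Literature.Analysis.Complex.weight φ t : ℂ) * g t := by
  unfold FFun hFun sechWeight Literature.Analysis.Complex.weight
  congr 1; ext t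
  rw [← mul_assoc]
  congr 1
  rw [show -((φ : ℂ) * t) = ((-(φ * t) : ℝ) : ℂ) by push_cast; ring, ← Complex.ofReal_exp,
    ← Complex.ofReal_mul]
  congr 1
  field_simp

/-- On the imaginary axis, `F` is the Fourier transform of `h`: `𝓕 h (s) = F(2π i s)`.
[cite: RieffelVandaele1977, Lemma 4.8 (proof)] -/
theorem fourier_hFun_eq (s : ℝ) : 𝓕 (hFun g) s = FFun g (2 * π * s * I) := by
  rw [Real.fourier_real_eq_integral_exp_smul]
  unfold FFun
  congr 1; ext t
  rw [smul_eq_mul]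
  congr 1
  congr 1
  push_cast
  ring

/-- **Injectivity of the kernel** (Rieffel–van Daele, proof of Lemma 4.8): a bounded continuous
`g` with `∫ e^{−φt}(e^{πt} + e^{−πt})^{−1} g(t) dt = 0` for all `|φ| < π` vanishes identically
(the kernel is `Literature.Analysis.Complex.weight φ t` of the Lemma 4.6 file).
[cite: RieffelVandaele1977, Lemma 4.8 (proof)] -/
theorem eq_zero_of_forall_integral_coshKernel_eq_zero (hg : Continuous g) {C : ℝ}
    (hC : ∀ t, ‖g t‖ ≤ C)
    (h : ∀ φ : ℝ, |φ| < π → ∫ t : ℝ, (Literature.Analysis.Complex.weight φ t : ℂ) * g t = 0) :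
    g = 0 := by
  -- `F` vanishes on the strip
  have hF : EqOn (FFun g) 0 piStrip := by
    refine (analyticOnNhd_FFun hg hC).eqOn_zero_of_preconnected_of_frequently_eq_zero
      isPreconnected_piStrip (z₀ := 0) (by simp [piStrip, Real.pi_pos]) ?_
    -- real points `1/(n+2)` accumulate at `0`
    have hseq : Tendsto (fun n : ℕ => ((1 / ((n : ℝ) + 2) : ℝ) : ℂ)) atTop (𝓝[≠] 0) := by
      refine tendsto_nhdsWithin_iff.2 ⟨?_, Eventually.of_forall fun n => ?_⟩
      · have h1 : Tendsto (fun n : ℕ => (1 / ((n : ℝ) + 2) : ℝ)) atTop (𝓝 0) :=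
          tendsto_const_nhds.div_atTop (tendsto_natCast_atTop_atTop.atTop_add tendsto_const_nhds)
        have h2 : Tendsto (fun n : ℕ => ((1 / ((n : ℝ) + 2) : ℝ) : ℂ)) atTop (𝓝 ((0 : ℝ) : ℂ)) :=
          (Complex.continuous_ofReal.tendsto 0).comp h1
        rwa [Complex.ofReal_zero] at h2
      · simp only [mem_compl_iff, mem_singleton_iff, ofReal_eq_zero, one_div, inv_eq_zero]
        positivity
    refine hseq.frequently (Frequently.of_forall fun n => ?_)
    have hφ : |(1 / ((n : ℝ) + 2) : ℝ)| < π := by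
      rw [abs_of_pos (by positivity)]
      calc (1 / ((n : ℝ) + 2) : ℝ) ≤ 1 / 2 := by
            rw [div_le_div_iff₀ (by positivity) (by norm_num)]; linarith [n.cast_nonneg (α := ℝ)]
        _ < π := by linarith [Real.two_le_pi]
    rw [FFun_ofReal]
    exact h _ hφ
  -- hence the Fourier transform of `h` vanishes
  have hfourier : 𝓕 (hFun g) = 0 := by
    ext s
    rw [fourier_hFun_eq, Pi.zero_apply]
    exact hF (by simp [piStrip, Real.pi_pos])
  -- Fourier inversion
  have hinv := (continuous_hFun hg).fourierInv_fourier_eq (integrable_hFun hg hC)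
    (by rw [hfourier]; exact integrable_zero _ _ _)
  rw [hfourier] at hinv
  have hzero : hFun g = 0 := by
    rw [← hinv]
    ext s
    simp [Real.fourierInv_eq]
  ext t
  have := congrFun hzero t
  simp only [hFun, Pi.zero_apply, mul_eq_zero, ofReal_eq_zero] at this
  rcases this with h0 | h0
  · exact absurd h0 (sechWeight_pos t).ne'
  · simpa using h0

end Literature.Analysis.Fourier
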